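import Summits.ValiantsHypothesis.ValiantsHypothesis.Theorems.GrenetZeonDualUnipotentThreeHalvesLongMassRankRowPencil
import Summits.ValiantsHypothesis.ValiantsHypothesis.Theorems.GrenetZeonDualUnipotentThreeHalvesLongMassWoodbury

/-!
# `GrenetZeon.DualUnipotentThreeHalves` (stmt-ValiantsHypothesis-24318), row r12 (RANK ROW) — part (G7b-2/3): TRANSFER NILPOTENCY, RANK REDUCTION, EXTRACTION

Part 2 of 3 of the kernel proof of `rankRow_holds : RankRow`.  §C **transfer nilpotency over a GENERIC commutative ring `K`** (`isNilpotent_transfer`):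
`A^b = 0` and `(A + tS)^b = 0` in `M_b(K[t])` ⇒ the transfer `G := (Σ_{j<b} (uA)^j)·(uS)` is nilpotent — by the factorisation `1 - u(A + tS) = (1 - uA)(1 - tG)`,
the two geometric inverses, and the `t`-coefficient recursion `coeff_t^k ((1 - tG)⁻¹) = G^k` against a `t`-degree bound; no determinants.  (Stated over an
opaque `K` because tactic rewriting with generic ring lemmas does not fire on matrices over the depth-3 tower `ℂ[s][u][t]`; instantiated at `K := ℂ[s][u]`.)
It is fed by `pencilT_pow_eq_zero`: the two-parameter nilpotency `(A₀ + sL + t₀S₀)^b = 0` for all complex `t₀` (from part 1's `pencilS_pow_eq_zero`) is a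
`t`-polynomial identity (`Polynomial.eq_zero_of_infinite_isRoot` with the roots `t₀ ∈ ℂ ⊂ ℂ[s][u]`).  §D rank reduction: `S₀ = P·Q₀` through `ℂ^{rank S₀}`
(`exists_rank_factorisation`, `Module.finBasis` of the column span), `(EF)^{c+1} = E (FE)^c F` and ✓ `SlowCore.pow_card_eq_zero_of_pow_eq_zero` over the
domain `ℂ[s][u]` ⇒ a nilpotent `E F` with inner dimension `c` has `(EF)^{c+1} = 0`.  §E extraction: with ✓ `RankRow.resolvent_add_of_transfer_pow_eq_zero`
(part (G7a), Woodbury with a nilpotent capacitance) and the `u^p`-coefficient comparison of ✓ `ResolventFlag.totalDegree_pow_apply_le_of_twist_pow_eq_zero`,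
`G^{r+1} = 0` gives `deg_s ((A₀ + S₀ + sL)^p)_{ij} ≤ (r+2)·⌊(b-1)/(q+1)⌋` (`totalDegree_pow_le_of_transfer_pow_eq_zero`).

HONEST FRAMING (crit-7 V49/V67/V70 words stand): the rank row is a CALIBRATION row (r12), now a theorem — it prices the locus «triangular in one
constant flag up to a skew part of bounded rank» at `c = 2√(r+2)` (+ `σ/(b√n)`); it is NOT progress on the research stub (c) `SlowCore.LongMassSlowLawInv`;
24318 / S3 / R2ᵖ OPEN; `VP ≠ VNP` is NOT proved.  Helper (`--supports stmt-ValiantsHypothesis-24318`, helper mode); no instances, no notation, no named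
facts.  STAGED PORT bytes by val-idea-29 g9 of `Cruxes/DualUnipotentThreeHalves/RankRow.lean` REV 2.1 @4cc029748180 §3 (this lineage never proposes
Theorems; a prover seat presses on the critic's GO).  Credit: val-idea-29 g8 (row, identities), g9 (proof). [folklore]
-/

set_option linter.dupNamespace false
set_option autoImplicit false

namespace Summit.ValiantsHypothesis.ValiantsHypothesis.Theorems.GrenetZeon.RankRow

noncomputable section

open MvPolynomial Matrix
open scoped BigOperators Polynomial
open Finset (range)
open Summit.ValiantsHypothesis.ValiantsHypothesis.Theorems.GrenetZeon.ResolventFlag (SRing cst)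

/-! ## §C Transfer nilpotency: `G = R_{A'}(u)·(u S₀)` is nilpotent over `ℂ[s][u]`

Rings: `SRing = ℂ[s]`, `URing = ℂ[s][u]`, `TRing = ℂ[s][u][t]`. -/

/-- `ℂ[s][u]`. -/
abbrev URing : Type := Polynomial SRing
/-- `ℂ[s][u][t]`. -/
abbrev TRing : Type := Polynomial URing

section Transfer
variable {b : ℕ}

/-- `(r • A).map f = f r • A.map f` for a ring hom `f`. -/
theorem map_smul_ringHom {R S : Type*} [CommSemiring R] [Semiring S] {ι κ : Type*} (f : R →+* S) (r : R)
    (M : Matrix ι κ R) : (r • M).map f = f r • M.map f := by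
  ext i j; simp [Matrix.map_apply, smul_eq_mul]

/-- A general constant embedding `ℂ → ℂ[s][u]` on rectangular matrices (agrees with `cst` on square ones). -/
def cmat {ι κ : Type*} (P : Matrix ι κ ℂ) : Matrix ι κ URing :=
  P.map ((Polynomial.C : SRing →+* URing).comp (C : ℂ →+* SRing))

/-- `cmat` agrees with ✓ `ResolventFlag.cst` on square matrices. -/
theorem cmat_eq_cst (P : Matrix (Fin b) (Fin b) ℂ) : cmat P = cst P := rfl

/-- `cmat` is multiplicative (rectangular shapes). -/
theorem cmat_mul {ι κ μ : Type*} [Fintype κ] (P : Matrix ι κ ℂ) (Q : Matrix κ μ ℂ) :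
    cmat (P * Q) = cmat P * cmat Q := by
  rw [cmat, cmat, cmat, Matrix.map_mul]

/-- The two-parameter pencil `A' + t·S₀` over `ℂ[s][u][t]` is nilpotent if `A' + t₀ S₀` is for every complex `t₀`. -/
theorem pencilT_pow_eq_zero (A₀ L S₀ : Matrix (Fin b) (Fin b) ℂ)
    (h : ∀ t₀ : ℂ, (pencilS (A₀ + t₀ • S₀) L) ^ b = 0) :
    (((pencilS A₀ L).map (Polynomial.C : SRing →+* URing)).map (Polynomial.C : URing →+* TRing)
      + (Polynomial.X : TRing) • (cst S₀).map (Polynomial.C : URing →+* TRing)) ^ b = 0 := by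
  classical
  set Mt := ((pencilS A₀ L).map (Polynomial.C : SRing →+* URing)).map (Polynomial.C : URing →+* TRing)
      + (Polynomial.X : TRing) • (cst S₀).map (Polynomial.C : URing →+* TRing) with hMt
  -- evaluation of `Mt` at a complex constant `t₀`
  have heval : ∀ t₀ : ℂ, Mt.map (Polynomial.evalRingHom (Polynomial.C (C t₀ : SRing) : URing)) =
      (pencilS (A₀ + t₀ • S₀) L).map (Polynomial.C : SRing →+* URing) := by
    intro t₀
    refine Matrix.ext fun i j => ?_
    simp only [hMt, Matrix.map_apply, Matrix.add_apply, Matrix.smul_apply, smul_eq_mul, pencilS, cst,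
      Polynomial.coe_evalRingHom, Polynomial.eval_add, Polynomial.eval_C, Polynomial.eval_mul, Polynomial.eval_X]
    simp only [map_add, map_mul]
    ring
  refine Matrix.ext fun i j => ?_
  rw [Matrix.zero_apply]
  apply Polynomial.eq_zero_of_infinite_isRoot
  refine Set.Infinite.mono (s := Set.range fun t₀ : ℂ => (Polynomial.C (C t₀ : SRing) : URing)) ?_ ?_
  · rintro _ ⟨t₀, rfl⟩
    show Polynomial.IsRoot ((Mt ^ b) i j) _
    rw [Polynomial.IsRoot.def]
    have h1 : Polynomial.eval (Polynomial.C (C t₀ : SRing) : URing) ((Mt ^ b) i j) =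
        ((Mt ^ b).map (Polynomial.evalRingHom (Polynomial.C (C t₀ : SRing) : URing))) i j := rfl
    rw [h1, Matrix.map_pow, heval t₀, ← Matrix.map_pow, h t₀, Matrix.map_apply, Matrix.zero_apply, map_zero]
  · exact Set.infinite_range_of_injective
      (Polynomial.C_injective.comp (MvPolynomial.C_injective (Fin 1) ℂ))

/-- `t`-coefficientwise projection `M_b(K[t]) → M_b(K)`. -/
def tcoeff {K : Type*} [CommRing K] (k : ℕ) (Z : Matrix (Fin b) (Fin b) (Polynomial K)) : Matrix (Fin b) (Fin b) K :=
  fun i j => (Z i j).coeff k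

/-- **Transfer nilpotency** (generic commutative ring `K`, `u ∈ K`). If `A^b = 0` and `(A + t S)^b = 0` over `K[t]`, then
`G = (Σ_{j<b} (uA)^j)·(uS)` is nilpotent over `K`. -/
theorem isNilpotent_transfer {K : Type*} [CommRing K] (u : K) (Au Su : Matrix (Fin b) (Fin b) K) (hAu : Au ^ b = 0)
    (hMt : (Au.map (Polynomial.C : K →+* Polynomial K) + (Polynomial.X : Polynomial K) •
      Su.map (Polynomial.C : K →+* Polynomial K)) ^ b = 0) :
    IsNilpotent ((∑ j ∈ Finset.range b, (u • Au) ^ j) * (u • Su)) := by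
  classical
  set R' : Matrix (Fin b) (Fin b) K := ∑ j ∈ Finset.range b, (u • Au) ^ j with hR'
  set G : Matrix (Fin b) (Fin b) K := R' * (u • Su) with hG
  set Ct : K →+* Polynomial K := Polynomial.C with hCt
  set t : Polynomial K := Polynomial.X with ht
  set At : Matrix (Fin b) (Fin b) (Polynomial K) := Au.map Ct with hAt
  set St : Matrix (Fin b) (Fin b) (Polynomial K) := Su.map Ct with hSt
  set Gt : Matrix (Fin b) (Fin b) (Polynomial K) := G.map Ct with hGt
  set Rt : Matrix (Fin b) (Fin b) (Polynomial K) := R'.map Ct with hRt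
  set ut : Polynomial K := Ct u with hut
  set Mt : Matrix (Fin b) (Fin b) (Polynomial K) := At + t • St with hMt'
  -- (1) `R'` is a two-sided inverse of `1 - u A'`
  have hx : (u • Au) ^ b = 0 := by rw [smul_pow, hAu, smul_zero]
  have hinv1 : (1 - u • Au) * R' = 1 := by rw [hR', mul_neg_geom_sum, hx, sub_zero]
  have hinv2 : R' * (1 - u • Au) = 1 := by rw [hR', geom_sum_mul_neg, hx, sub_zero]
  -- transported to `K[t]`
  have hmap_uAu : (u • Au).map Ct = ut • At := by rw [hut, hAt]; exact map_smul_ringHom Ct u Au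
  have hinv1t : (1 - ut • At) * Rt = 1 := by
    have h0 := congrArg Ct.mapMatrix hinv1
    simp only [map_mul, map_sub, map_one, RingHom.mapMatrix_apply] at h0
    rw [hmap_uAu] at h0
    exact h0
  have hinv2t : Rt * (1 - ut • At) = 1 := by
    have h0 := congrArg Ct.mapMatrix hinv2
    simp only [map_mul, map_sub, map_one, RingHom.mapMatrix_apply] at h0
    rw [hmap_uAu] at h0
    exact h0
  have hGt' : Gt = Rt * (ut • St) := by
    rw [hGt, hG, Matrix.map_mul, hRt, hut, hSt, map_smul_ringHom]
  -- (2) factorisation `1 - u·Mt = (1 - u A')(1 - t G)`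
  have hfact : (1 - ut • At) * (1 - t • Gt) = 1 - ut • Mt := by
    calc (1 - ut • At) * (1 - t • Gt)
        = (1 - ut • At) - t • (((1 - ut • At) * Rt) * (ut • St)) := by
          rw [mul_sub, mul_one, hGt', Matrix.mul_smul, Matrix.mul_assoc]
      _ = 1 - ut • Mt := by
          rw [hinv1t, Matrix.one_mul, hMt', smul_add, smul_comm t ut St, sub_sub]
  -- (3) `Mt^b = 0` gives the geometric inverse of `1 - u·Mt`
  have hy : (ut • Mt) ^ b = 0 := by rw [smul_pow, hMt, smul_zero]
  set Sg : Matrix (Fin b) (Fin b) (Polynomial K) := ∑ p ∈ Finset.range b, (ut • Mt) ^ p with hSg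
  have hgeo1 : (1 - ut • Mt) * Sg = 1 := by rw [hSg, mul_neg_geom_sum, hy, sub_zero]
  -- (4) `(1 - tG) Q = 1` with `Q = Sg (1 - uA')`
  have hX : (1 - t • Gt) * Sg = Rt := by
    calc (1 - t • Gt) * Sg = (Rt * (1 - ut • At)) * ((1 - t • Gt) * Sg) := by rw [hinv2t, Matrix.one_mul]
      _ = Rt * (((1 - ut • At) * (1 - t • Gt)) * Sg) := by simp only [Matrix.mul_assoc]
      _ = Rt := by rw [hfact, hgeo1, Matrix.mul_one]
  set Q : Matrix (Fin b) (Fin b) (Polynomial K) := Sg * (1 - ut • At) with hQ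
  have hQ1 : (1 - t • Gt) * Q = 1 := by rw [hQ, ← Matrix.mul_assoc, hX, hinv2t]
  have hQrec : Q = (1 : Matrix (Fin b) (Fin b) K).map Ct + t • (Gt * Q) := by
    have h0 : Q - t • (Gt * Q) = 1 := by
      rw [sub_mul, Matrix.one_mul, Matrix.smul_mul] at hQ1; exact hQ1
    rw [Matrix.map_one Ct (map_zero Ct) (map_one Ct)]
    rw [← h0]; abel
  -- (5) coefficient recursion: `tcoeff k Q = G^k`
  have hcoeff : ∀ k : ℕ, tcoeff k Q = G ^ k := by
    intro k
    induction k with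
    | zero =>
      refine Matrix.ext fun i j => ?_
      show (Q i j).coeff 0 = (G ^ 0) i j
      rw [hQrec, Matrix.add_apply, Matrix.smul_apply, smul_eq_mul, Polynomial.coeff_add, Matrix.map_apply,
        hCt, Polynomial.coeff_C_zero, ht, Polynomial.coeff_X_mul_zero, add_zero, pow_zero]
    | succ k ih =>
      refine Matrix.ext fun i j => ?_
      show (Q i j).coeff (k + 1) = (G ^ (k + 1)) i j
      rw [hQrec, Matrix.add_apply, Matrix.smul_apply, smul_eq_mul, Polynomial.coeff_add, Matrix.map_apply,
        hCt, Polynomial.coeff_C, if_neg (Nat.succ_ne_zero k), zero_add, ht, Polynomial.coeff_X_mul, Matrix.mul_apply,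
        Polynomial.finsetSum_coeff, pow_succ', ← ih, Matrix.mul_apply]
      refine Finset.sum_congr rfl fun l _ => ?_
      rw [hGt, Matrix.map_apply, Polynomial.coeff_C_mul]
      rfl
  -- (6) a `t`-degree bound on `Q` kills a power of `G`
  clear_value Q
  obtain ⟨D, hDlt⟩ : ∃ D : ℕ, ∀ i j : Fin b, (Q i j).natDegree < D := by
    refine ⟨(Finset.univ : Finset (Fin b × Fin b)).sup (fun ij => (Q ij.1 ij.2).natDegree) + 1, fun i j => ?_⟩
    have hle := Finset.le_sup (f := fun ij : Fin b × Fin b => (Q ij.1 ij.2).natDegree) (Finset.mem_univ (i, j))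
    simp only at hle
    omega
  refine ⟨D, ?_⟩
  rw [← hcoeff D]
  refine Matrix.ext fun i j => ?_
  show (Q i j).coeff D = 0
  exact Polynomial.coeff_eq_zero_of_natDegree_lt (hDlt i j)

end Transfer

/-! ## §D Rank reduction: `G = E·F` through `ℂ[s][u]^{rank S₀}`, so `G^{rank S₀ + 1} = 0` -/

section RankReduction
variable {b : ℕ}

/-- Rank factorisation of a complex matrix through `ℂ^{rank}`. -/
theorem exists_rank_factorisation (S₀ : Matrix (Fin b) (Fin b) ℂ) :
    ∃ (P : Matrix (Fin b) (Fin S₀.rank) ℂ) (Q : Matrix (Fin S₀.rank) (Fin b) ℂ), S₀ = P * Q := by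
  classical
  let V : Submodule ℂ (Fin b → ℂ) := LinearMap.range S₀.mulVecLin
  let bV : Module.Basis (Fin S₀.rank) ℂ V := Module.finBasis ℂ V
  have hmem : ∀ j : Fin b, S₀.mulVecLin (Pi.single j 1) ∈ V := fun j => LinearMap.mem_range_self _ _
  refine ⟨fun i a => ((bV a : V) : Fin b → ℂ) i, fun a j => bV.repr ⟨_, hmem j⟩ a, ?_⟩
  refine Matrix.ext fun i j => ?_
  have h1 : S₀ i j = ((⟨_, hmem j⟩ : V) : Fin b → ℂ) i := by
    simp
  rw [h1, ← bV.sum_repr ⟨_, hmem j⟩]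
  simp only [Matrix.mul_apply, Submodule.coe_sum, Submodule.coe_smul, Finset.sum_apply, Pi.smul_apply,
    smul_eq_mul]
  refine Finset.sum_congr rfl fun a _ => ?_
  exact mul_comm _ _

/-- Powers of `E·F` factor through `F·E`: `(EF)^{k+1} = E (FE)^k F`. -/
theorem mul_pow_succ_eq {K : Type*} [CommRing K] {c : ℕ} (E : Matrix (Fin b) (Fin c) K) (F : Matrix (Fin c) (Fin b) K)
    (k : ℕ) : (E * F) ^ (k + 1) = E * (F * E) ^ k * F := by
  induction k with
  | zero => rw [zero_add, pow_one, pow_zero, Matrix.mul_one]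
  | succ k ih =>
    rw [pow_succ, ih, pow_succ]
    simp only [Matrix.mul_assoc]

/-- **Rank reduction**: a nilpotent `E·F` with inner dimension `c` over a domain satisfies `(EF)^{c+1} = 0`. -/
theorem pow_succ_eq_zero_of_isNilpotent_mul {K : Type*} [CommRing K] [IsDomain K] {c : ℕ}
    (E : Matrix (Fin b) (Fin c) K) (F : Matrix (Fin c) (Fin b) K) (h : IsNilpotent (E * F)) :
    (E * F) ^ (c + 1) = 0 := by
  obtain ⟨D, hD⟩ := h
  have hH : (F * E) ^ (D + 1) = 0 := by
    rw [mul_pow_succ_eq F E D, hD, Matrix.mul_zero, Matrix.zero_mul]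
  have hHc : (F * E) ^ c = 0 :=
    Summit.ValiantsHypothesis.ValiantsHypothesis.Theorems.GrenetZeon.SlowCore.pow_card_eq_zero_of_pow_eq_zero _ hH
  rw [mul_pow_succ_eq, hHc, Matrix.mul_zero, Matrix.zero_mul]

end RankReduction


/-! ## §E Extraction: Woodbury expansion of `(1 - u·M)⁻¹` and `u`-coefficient comparison -/

section Extraction
variable {b : ℕ}

/-- Mapped into `ℂ[s][u]`, the pencil of `A₀ + S₀` splits as the pencil of `A₀` plus the constant `cst S₀`. -/
theorem map_C_pencilS_add (A₀ L S₀ : Matrix (Fin b) (Fin b) ℂ) :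
    (pencilS (A₀ + S₀) L).map (Polynomial.C : SRing →+* URing) =
      (pencilS A₀ L).map (Polynomial.C : SRing →+* URing) + cst S₀ := by
  refine Matrix.ext fun i j => ?_
  simp only [pencilS, cst, Matrix.map_apply, Matrix.add_apply, Matrix.smul_apply, smul_eq_mul, map_add, map_mul]
  ring

/-- **Extraction.** If `A' = A₀ + sL` is admissible of weight 1 and the transfer matrix `G = R_{A'}(u)(u S₀)` satisfies
`G^{r+1} = 0`, then every power of `M = A' + S₀` has entries of `s`-degree `≤ (r+2)·⌊(b-1)/(q+1)⌋`. -/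
theorem totalDegree_pow_le_of_transfer_pow_eq_zero (π : Equiv.Perm (Fin b)) (q r : ℕ)
    (A₀ L S₀ : Matrix (Fin b) (Fin b) ℂ) (hA' : Adm π q 1 (pencilS A₀ L))
    (hG : ((∑ j ∈ Finset.range b,
        ((Polynomial.X : URing) • (pencilS A₀ L).map (Polynomial.C : SRing →+* URing)) ^ j) *
      ((Polynomial.X : URing) • cst S₀)) ^ (r + 1) = 0)
    (p : ℕ) (i j : Fin b) :
    (((pencilS (A₀ + S₀) L) ^ p) i j).totalDegree ≤ (r + 2) * ((b - 1) / (q + 1)) := by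
  classical
  set κ : ℕ := (b - 1) / (q + 1) with hκ
  set A' : Matrix (Fin b) (Fin b) SRing := pencilS A₀ L with hA'def
  set M : Matrix (Fin b) (Fin b) SRing := pencilS (A₀ + S₀) L with hM
  set u : URing := Polynomial.X with hu
  set Au : Matrix (Fin b) (Fin b) URing := A'.map (Polynomial.C : SRing →+* URing) with hAu
  set Su : Matrix (Fin b) (Fin b) URing := cst S₀ with hSu
  set Mu : Matrix (Fin b) (Fin b) URing := M.map (Polynomial.C : SRing →+* URing) with hMu
  set R' : Matrix (Fin b) (Fin b) URing := ∑ j ∈ Finset.range b, (u • Au) ^ j with hR'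
  set G : Matrix (Fin b) (Fin b) URing := R' * (u • Su) with hGdef
  set N : Matrix (Fin b) (Fin b) URing := ∑ a ∈ Finset.range (r + 1), G ^ a with hN
  set W : Matrix (Fin b) (Fin b) URing := R' + R' * (u • Su) * N * R' with hW
  -- nilpotency of `A'` and of `u • Au`
  have hAb : A' ^ b = 0 := eq_zero_of_adm (adm_pow hA' b) le_rfl
  have hx : (u • Au) ^ b = 0 := by
    rw [smul_pow, hAu, ← Matrix.map_pow A' (Polynomial.C : SRing →+* URing) b, hAb,
      Matrix.map_zero _ (map_zero _), smul_zero]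
  -- (1) Woodbury: `(1 - u·Mu) W = 1`
  have hMu' : Mu = Au + Su := by
    rw [hMu, hM, hAu, hSu, hA'def]; exact map_C_pencilS_add A₀ L S₀
  have h5 : (1 - u • Mu) * W = 1 := by
    have h := resolvent_add_of_transfer_pow_eq_zero (u • Au) (u • Su) b (r + 1) hx hG
    rw [hMu', smul_add]; exact h
  -- (2) geometric sum for `u·Mu`
  have h6 : (∑ a ∈ Finset.range (p + 1), (u • Mu) ^ a) = W - (u • Mu) ^ (p + 1) * W := by
    have hgs : (∑ a ∈ Finset.range (p + 1), (u • Mu) ^ a) * (1 - u • Mu) = 1 - (u • Mu) ^ (p + 1) :=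
      geom_sum_mul_neg _ _
    calc (∑ a ∈ Finset.range (p + 1), (u • Mu) ^ a)
        = (∑ a ∈ Finset.range (p + 1), (u • Mu) ^ a) * ((1 - u • Mu) * W) := by rw [h5, Matrix.mul_one]
      _ = (1 - (u • Mu) ^ (p + 1)) * W := by rw [← Matrix.mul_assoc, hgs]
      _ = W - (u • Mu) ^ (p + 1) * W := by rw [sub_mul, Matrix.one_mul]
  have hterm : ∀ a : ℕ, Polynomial.coeff (((u • Mu) ^ a) i j) p = if p = a then (M ^ a) i j else 0 := by
    intro a
    rw [smul_pow, Matrix.smul_apply, smul_eq_mul, hMu, ← Matrix.map_pow M (Polynomial.C : SRing →+* URing) a]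
    change Polynomial.coeff (u ^ a * Polynomial.C ((M ^ a) i j)) p = _
    rw [mul_comm, hu, Polynomial.coeff_C_mul_X_pow]
  have hL : Polynomial.coeff ((∑ a ∈ Finset.range (p + 1), (u • Mu) ^ a) i j) p = (M ^ p) i j := by
    rw [Matrix.sum_apply, Polynomial.finsetSum_coeff,
      Finset.sum_eq_single_of_mem p (Finset.mem_range.2 (Nat.lt_succ_self p))
        (fun a _ hap => by rw [hterm a, if_neg (Ne.symm hap)]), hterm p, if_pos rfl]
  have hR2 : Polynomial.coeff ((((u • Mu) ^ (p + 1)) * W) i j) p = 0 := by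
    rw [smul_pow, Matrix.smul_mul, Matrix.smul_apply, smul_eq_mul, hu, Polynomial.coeff_X_pow_mul', if_neg (by omega)]
  -- (3) degrees
  have hdegR' : DegLE κ R' := by
    refine degLE_sum _ _ fun a _ => ?_
    rw [smul_pow, hAu, ← Matrix.map_pow A' (Polynomial.C : SRing →+* URing) a]
    exact degLE_X_pow_smul_map_C (A' ^ a) (fun i j => totalDegree_le_of_adm (adm_pow hA' a) i j) a
  have hdegSu : DegLE 0 (u • Su) := by rw [hu, hSu]; exact degLE_X_mul (degLE_cst S₀)
  have hdegG : DegLE κ G := by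
    have h := degLE_mul hdegR' hdegSu
    rw [Nat.add_zero] at h
    exact h
  have hdegN : DegLE (r * κ) N := by
    refine degLE_sum _ _ fun a ha => ?_
    have har : a ≤ r := Nat.lt_succ_iff.1 (Finset.mem_range.1 ha)
    exact degLE_mono (degLE_pow hdegG a) (Nat.mul_le_mul_right κ har)
  have hdegW : DegLE ((r + 2) * κ) W := by
    have h := degLE_mul (degLE_mul (degLE_mul hdegR' hdegSu) hdegN) hdegR'
    have hk : κ + 0 + r * κ + κ = (r + 2) * κ := by ring
    rw [hk] at h
    exact degLE_add (degLE_mono hdegR' (Nat.le_mul_of_pos_left κ (by omega))) h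
  -- (4) conclusion
  have hcoef : Polynomial.coeff ((∑ a ∈ Finset.range (p + 1), (u • Mu) ^ a) i j) p =
      Polynomial.coeff ((W - (u • Mu) ^ (p + 1) * W) i j) p := by rw [h6]
  rw [hL, Matrix.sub_apply, Polynomial.coeff_sub, hR2, sub_zero] at hcoef
  rw [hcoef]
  exact hdegW i j p

end Extraction

end

end Summit.ValiantsHypothesis.ValiantsHypothesis.Theorems.GrenetZeon.RankRow
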